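import Summits.NavierStokesRegularity.NavierStokesRegularity.Theorems.ScenarioCensusScrewBlowdownResidual
import Summits.NavierStokesRegularity.NavierStokesRegularity.Theorems.TypeIAncientMildForwardUniqueness
import HarnessLib

/-!
# LINE «screw-blowdown» port, part 8/13: v1.7 the residual S3-lin as a PROPAGATION ESTIMATE — `FarPastSpreading` ⇔ S3-lin, `LocalPersistence` ⇒ FS,
# the cell from LP / FS, LP from (L′); the class tools by name from `TypeIAncientMildForwardUniqueness`

Re-homed for the scenario census (typer seat ns-census-typer-1 g7; lead g9 RULINGS [7] 20:33Z / [8] 21:03Z / [12](b) 21:58Z: «screw-blowdown v1.8 =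
version of record; `Row_A13isqT` DECIDED IN KERNEL → CANDIDATE-DECIDED member under A13 (row already TREE); typer-1 slot 3 port of record =
`ScrewBlowdown_port_v1_8.lean` bb5f719a8be448dd (stub-free)»; lead g10 RULINGS [1](b) 22:36Z / [2] 22:42Z: «port v1.9 ffe1ad3d1d25e376 = port of record (idea-crit-3 DIFF-CHECK 22:40:40Z CONFORMS); slot 4 = its S3
appendix ADMISSIBLE after slot 3»; ref PRE-CHECKs items 13 / 15 / 20 / 27): VERBATIM PORT of ns-idea-4 LINE g12-1 «screw-blowdown» PORT copy
`pub/ideators/ns-idea-4/lines/screw-blowdown/port/ScrewBlowdown_port_v1_9.lean` sha16 ffe1ad3d1d25e376 (2890 l.; lean check rc 0, 0 sorry; = the v1.8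
port copy bb5f719a8be448dd as a literal prefix — itself the v1.7 copy 674e939b7b0b34e8 + the `LocalPersistence` attack appendix `…LP` + the consequences
`localPersistence_holds` / `farPastSpreading_holds` / `linearConeLiouville_holds` / `row_A13isqT_proved` — plus the v1.9 S3 block: `vanishingBlowdownLiouville_holds`,
`row_ArecT_proved`; parts 1–3 landed while v1.8 was the copy of record, text identical),
split for the 400-line rule into `ScenarioCensusScrewBlowdown` (§1–§3: objects, the cell `Row_A13isqT`, obligation Props, S1 PROVED) →
`…Plumbing` (§4, S2 PROVED) → `…Bridges` (§5 + v1.3) → `…Recurrent` (v1.4, `Row_ArecT`) → `…OffAxis` (v1.5 a) → `…Cone` (v1.5 b: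
`farPast_linearCone_smallness_of_screw`) → `…Residual` (v1.5 c + v1.6: `LinearConeLiouville`, DSS rungs) → `…Propagation` (v1.7: FS, LP,
reductions; the three class-general tools are NOT re-declared — taken BY NAME, general `E`, from `Theorems/TypeIAncientMildForwardUniqueness.lean`,
ns-idea-4 extract a1b589f6dec7da83, p671177) → `…LPTools` / `…LPDuhamel` / `…LP` (the appendix: Gaussian locality, the three-term Oseen split,
time weights; `duhamel_bound`; the bootstrap `one_step` / `persist` / `localPersistence` + the consequences incl. `row_A13isqT_proved`) →
`…Vanishing` (v1.9: S3 proved, `row_ArecT_proved`) → `…Keys` (census keys `Row_A13isqT` / `Row_ArecT` + `_excluded`).  Lean text VERBATIM in namespaces `…Theorems.ScenarioCensus.ScrewBlowdown` / `…ScrewBlowdownLP` (the line's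
`…Lines.ScrewBlowdownPort` / `…PortLP` re-homed; qualified references renamed accordingly); port edits: `local notation "E3"` → `abbrev E3` (the
appendix `open`s it), `@[conjecture]` on `VanishingBlowdownLiouville` only (part 1 landed while S3 was open; an obligation node, now with the closed
witness `vanishingBlowdownLiouville_holds`), seven one-line docstrings added, `continuous_rotZ_angle'` not re-declared (it restates the tree's
`Literature.Analysis.FluidPDE.continuous_rotZ_angle`, gate lint `dedup.landed`; its uses renamed), the line's `set_option linter.unusedVariables false` dropped (five proof lambdas
bind the unused `θ₀ h` as `_ _`; the unused hypothesis binders of `hasVanishingBlowdown_of_axiallyRecurrent` / `pointwise_small_of_zoom_small` are spelled `_hu` / `_hΛ`,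
statements otherwise identical); `set_option maxHeartbeats … in` of the appendix kept as in the line.

No census VALUE is moved by this file (row A13 is TREE already; the lead books the member A13isq-T); NS regularity is NOT proved; (L′)
`SymmetryModuliCount.TypeIAncientLiouville` is untouched (hypothesis of bridges only); no summit statement is proved by this file.
-/

-- the summit and its single problem share the name `NavierStokesRegularity` (D-0017 nested layout)
set_option linter.dupNamespace false

namespace Summit.NavierStokesRegularity.NavierStokesRegularity.Theorems.ScenarioCensus.ScrewBlowdown

open Set Function Filter Topology
open Literature.Analysis Literature.Analysis.FluidPDE
open Summit.NavierStokesRegularity.NavierStokesRegularity.Theorems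

/-! ### v1.7 — the residual S3-lin is a PROPAGATION ESTIMATE (additive; the reductions are PROVED)

`LinearConeLiouville` (S3-lin) asks for a Liouville theorem.  Modulo two facts proved HERE from the tree's Oseen
calculus — (i) **eventual smallness ⇒ vanishing in the far past** (`eq_zero_of_eventuallySmall`: the tree's
small-constant bootstrap `smallConstantLiouville_eq_zero`, KNSS 2009 §4, transported to `(−∞,T)` by the class's
time-translation invariance `IsTypeIAncientMild.comp_sub_right`) and (ii) **forward uniqueness in the class**
(`eq_zero_of_vanishing_past`: a field of the class vanishing for `t < T` vanishes for `t < 0`; block-halving with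
`norm_oseenDuhamel_le_const`) — S3-lin is EQUIVALENT (`linearConeLiouville_of_farPastSpreading`,
`farPastSpreading_of_linearConeLiouville`) to the a-priori estimate

  `FarPastSpreading`: class ∧ far-past smallness on every linear cone ⇒ far-past smallness EVERYWHERE,

and FOLLOWS (`farPastSpreading_of_localPersistence`, an elementary covering argument: a point with
`|x_h| = R ≥ K(−t)` lay deep inside the small cone at time `−2R/K`) from the symmetry-free, cone-free LOCAL estimate

  `LocalPersistence`: for `u ∈ A_C`, relative smallness `√(−s₀)‖u(s₀,·)‖ ≤ ε` on a ball `B(x,R)`,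
  `R ≥ Λ(C,ε′)√(−s₀)`, persists at the centre: `√(−t)‖u(t,x)‖ ≤ ε′` for `s₀ ≤ 2t`, `t < 0`

— «persistence of smallness at the centre of a large ball under a Type-I a-priori bound» (heuristic: under
`|u| ≤ C/√(−σ)` advection moves information by `≤ 2C√(−s₀) ≪ R`, diffusion by `√(−s₀) ≪ R`, and the exterior acts on
the centre only through Oseen-kernel tails of relative size `O(C²/Λ)`; cf. the local-in-space short-time estimates
of Jia–Šverák 2014 and Barker–Prange 2020 for local-energy solutions — here with a GLOBAL `L∞` Type-I bound; the
tree's far-field Oseen files `OseenDuhamelFar`, `OseenSliceFarField`, `KNSSMildDecayHorizontal` are the expected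
tools).  `LocalPersistence` is the new declared RESEARCH residual of the cell (`row_A13isqT_of_localPersistence`);
it is implied by (L′) (`localPersistence_of_typeIAncientLiouville`) and decides the cell; S3-lin and S3 remain as the
weaker-to-stronger chain `LocalPersistence ⇒ FarPastSpreading ⇔ LinearConeLiouville ⇐ VanishingBlowdownLiouville`.
HONEST: no residual is proved; the equivalence FS ⇔ S3-lin is modulo theorems proved in this file, not new
mathematics; LP has not been checked against the precise hypotheses of the cited local-in-space results. -/

-- `isTypeIAncientMild_of_decay`, `eq_zero_of_eventuallySmall`, `eq_zero_of_vanishing_past`: v1.7 restates here (for `E3`) the three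
-- class-general tools of `Theorems/TypeIAncientMildForwardUniqueness.lean` (ns-idea-4 extract a1b589f6dec7da83, general `E`);
-- the tree takes them BY NAME from that module.

/-- **FarPastSpreading** (a-priori ESTIMATE; research): for a class member, far-past smallness on every linear cone
about the axis spreads to far-past smallness EVERYWHERE.  [proposed residual form of S3-lin; symmetry-free] -/
def FarPastSpreading : Prop :=
  ∀ (C : ℝ) (u : ℝ → E3 → E3), IsTypeIAncientMild C u →
    (∀ ε > (0 : ℝ), ∀ K > (0 : ℝ), ∃ T < (0 : ℝ), ∀ t < T, ∀ x : E3,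
      x 0 ^ 2 + x 1 ^ 2 ≤ K ^ 2 * t ^ 2 → Real.sqrt (-t) * ‖u t x‖ ≤ ε) →
    ∀ ε > (0 : ℝ), ∃ T < (0 : ℝ), ∀ t < T, ∀ x : E3, Real.sqrt (-t) * ‖u t x‖ ≤ ε

/-- **LocalPersistence** (LOCAL a-priori estimate; the new declared RESEARCH residual; symmetry-free, cone-free):
«persistence of smallness at the centre of a large ball under a Type-I bound» — for `u ∈ A_C`, relative smallness
`√(−s₀)‖u(s₀,x′)‖ ≤ ε` on `B(x,R)` with `R ≥ Λ√(−s₀)` gives `√(−t)‖u(t,x)‖ ≤ ε′` at every `t ∈ [s₀/2, 0)`;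
`ε, Λ` depend on `C, ε′` only.  [proposed; cf. Jia–Šverák 2014, Barker–Prange 2020 (local-in-space estimates)] -/
def LocalPersistence : Prop :=
  ∀ (C : ℝ), ∀ ε' > (0 : ℝ), ∃ ε > (0 : ℝ), ∃ Λ > (0 : ℝ), ∀ (u : ℝ → E3 → E3), IsTypeIAncientMild C u →
    ∀ (s₀ t : ℝ) (x : E3) (R : ℝ), s₀ ≤ 2 * t → t < 0 → Λ * Real.sqrt (-s₀) ≤ R →
      (∀ x' : E3, dist x' x ≤ R → Real.sqrt (-s₀) * ‖u s₀ x'‖ ≤ ε) →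
      Real.sqrt (-t) * ‖u t x‖ ≤ ε'

/-- **S3-lin ⇐ FarPastSpreading** (PROVED reduction: far-past global smallness below the KNSS threshold `1/(8C₀)`
⇒ zero on `(−∞,T)` by (i) ⇒ zero on `(−∞,0)` by (ii)). -/
theorem linearConeLiouville_of_farPastSpreading (hFS : FarPastSpreading) : LinearConeLiouville := by
  intro C u hu hcone
  have hC₀ : 0 < oseenSliceConst E3 := oseenSliceConst_pos
  set A : ℝ := 1 / (16 * oseenSliceConst E3) with hAdef
  have hA0 : 0 < A := by rw [hAdef]; positivity
  have hA : A < 1 / (8 * oseenSliceConst E3) := by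
    rw [hAdef]
    gcongr
    linarith
  obtain ⟨T, hT, hT'⟩ := hFS C u hu hcone A hA0
  have hsmall : ∀ τ < T, ∀ y, ‖u τ y‖ ≤ A / Real.sqrt (-τ) := by
    intro τ hτ y
    have hs : 0 < Real.sqrt (-τ) := Real.sqrt_pos.2 (by linarith)
    rw [le_div_iff₀ hs, mul_comm]
    exact hT' τ hτ y
  exact eq_zero_of_vanishing_past hu (eq_zero_of_eventuallySmall hu hT hA hsmall)

/-- Ordering: S3-lin ⇒ FarPastSpreading (so the two are EQUIVALENT modulo (i), (ii)). -/
theorem farPastSpreading_of_linearConeLiouville (hL : LinearConeLiouville) : FarPastSpreading := by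
  intro C u hu hcone ε hε
  refine ⟨-1, by norm_num, fun t ht x => ?_⟩
  rw [hL C u hu hcone t (by linarith) x, norm_zero, mul_zero]
  exact hε.le

/-- Horizontal components are bounded by the norm. -/
theorem horiz_sq_le_norm_sq (z : E3) : z 0 ^ 2 + z 1 ^ 2 ≤ ‖z‖ ^ 2 := by
  rw [EuclideanSpace.norm_eq, Real.sq_sqrt (Finset.sum_nonneg fun i _ => by positivity)]
  simp only [Fin.sum_univ_three, Real.norm_eq_abs, sq_abs]
  nlinarith [sq_nonneg (z 2)]

/-- **FarPastSpreading ⇐ LocalPersistence** (PROVED, elementary covering: a far point `|x_h| = R ≥ −t` at a far-past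
time `t` lay, at time `s₀ = −2R ≤ 2t`, at the centre of a ball of radius `R ≥ Λ√(2R)` inside the small unit cone). -/
theorem farPastSpreading_of_localPersistence (hLP : LocalPersistence) : FarPastSpreading := by
  intro C u hu hcone ε' hε'
  obtain ⟨ε, hε, Λ, hΛ, hP⟩ := hLP C ε' hε'
  obtain ⟨T₁, hT₁, hT₁'⟩ := hcone (min ε ε') (lt_min hε hε') 1 one_pos
  refine ⟨min T₁ (-(2 * Λ ^ 2 + 1)), lt_of_le_of_lt (min_le_left _ _) hT₁, fun t ht x => ?_⟩
  have ht1 : t < T₁ := lt_of_lt_of_le ht (min_le_left _ _)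
  have ht2 : t < -(2 * Λ ^ 2 + 1) := lt_of_lt_of_le ht (min_le_right _ _)
  have ht0 : t < 0 := by nlinarith
  by_cases hin : x 0 ^ 2 + x 1 ^ 2 ≤ (1 : ℝ) ^ 2 * t ^ 2
  · exact (hT₁' t ht1 x hin).trans (min_le_right _ _)
  push Not at hin
  -- the far point: `R = |x_h| > −t`
  set ρ : ℝ := x 0 ^ 2 + x 1 ^ 2 with hρ
  have hρt : t ^ 2 < ρ := by simpa using hin
  set R : ℝ := Real.sqrt ρ with hRdef
  have hρ0 : 0 ≤ ρ := by rw [hρ]; positivity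
  have hR2 : R ^ 2 = ρ := Real.sq_sqrt hρ0
  have hRt : -t < R := by
    have h1 : Real.sqrt (t ^ 2) < Real.sqrt ρ := Real.sqrt_lt_sqrt (sq_nonneg _) hρt
    rw [Real.sqrt_sq_eq_abs, abs_of_neg ht0] at h1
    exact h1
  have hR0 : 0 < R := by linarith
  set s₀ : ℝ := -(2 * R) with hs₀
  have hs₀t : s₀ ≤ 2 * t := by rw [hs₀]; linarith
  have hΛR : Λ * Real.sqrt (-s₀) ≤ R := by
    -- `Λ √(2R) ≤ R` iff `2 Λ² R ≤ R²` iff `2Λ² ≤ R`, and `R > −t > 2Λ² + 1`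
    have h2 : 2 * Λ ^ 2 ≤ R := by linarith
    have hns : -s₀ = 2 * R := by rw [hs₀]; ring
    rw [hns]
    have h3 : (Λ * Real.sqrt (2 * R)) ^ 2 ≤ R ^ 2 := by
      rw [mul_pow, Real.sq_sqrt (by linarith)]
      nlinarith
    have h4 : 0 ≤ Λ * Real.sqrt (2 * R) := by positivity
    nlinarith [h3, h4]
  have hball : ∀ x' : E3, dist x' x ≤ R → Real.sqrt (-s₀) * ‖u s₀ x'‖ ≤ ε := by
    intro x' hx'
    have hs₀T : s₀ < T₁ := by linarith
    refine (hT₁' s₀ hs₀T x' ?_).trans (min_le_left _ _)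
    -- `|x'_h|² ≤ 2|x_h|² + 2|x'_h − x_h|² ≤ 2R² + 2R² = s₀²`
    have hz : (x' - x) 0 ^ 2 + (x' - x) 1 ^ 2 ≤ R ^ 2 := by
      have h1 := horiz_sq_le_norm_sq (x' - x)
      have h2 : ‖x' - x‖ ≤ R := by rwa [← dist_eq_norm]
      have h3 : ‖x' - x‖ ^ 2 ≤ R ^ 2 := pow_le_pow_left₀ (norm_nonneg _) h2 2
      linarith
    have e0 : x' 0 = x 0 + (x' - x) 0 := by simp
    have e1 : x' 1 = x 1 + (x' - x) 1 := by simp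
    rw [e0, e1]
    have hs2 : (1 : ℝ) ^ 2 * s₀ ^ 2 = 4 * R ^ 2 := by rw [hs₀]; ring
    rw [hs2]
    nlinarith [sq_nonneg (x 0 - (x' - x) 0), sq_nonneg (x 1 - (x' - x) 1), hR2, hz]
  exact hP u hu s₀ t x R hs₀t ht0 hΛR hball

/-- The cell from the new local residual: **`Row_A13isqT ⇐ LocalPersistence`** (kernel-checked chain
LP ⇒ FS ⇒ S3-lin ⇒ row). -/
theorem row_A13isqT_of_localPersistence (hLP : LocalPersistence) : Row_A13isqT :=
  row_A13isqT_of_linearConeLiouville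
    (linearConeLiouville_of_farPastSpreading (farPastSpreading_of_localPersistence hLP))

/-- `Row_A13isqT ⇐ FarPastSpreading`. -/
theorem row_A13isqT_of_farPastSpreading (hFS : FarPastSpreading) : Row_A13isqT :=
  row_A13isqT_of_linearConeLiouville (linearConeLiouville_of_farPastSpreading hFS)

/-- BRIDGE BY NAME: (L′) ⇒ LocalPersistence (the class is then `{0}`; strict sub-statement — the converse must
FAIL, probe). -/
theorem localPersistence_of_typeIAncientLiouville
    (hL : Summit.NavierStokesRegularity.NavierStokesRegularity.Theses.SymmetryModuliCount.TypeIAncientLiouville) :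
    LocalPersistence := by
  intro C ε' hε'
  refine ⟨1, one_pos, 1, one_pos, fun u hu s₀ t x R _ ht _ _ => ?_⟩
  have h0 : u t x = 0 := hL C u (isTypeIAncientMild_iff.1 hu) t ht x
  rw [h0, norm_zero, mul_zero]
  exact hε'.le

end Summit.NavierStokesRegularity.NavierStokesRegularity.Theorems.ScenarioCensus.ScrewBlowdown
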